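import Literature.AnabelianGeometry.EtaleTheta.BiKummerRootTransport

/-!
# [EtTh] §4: `Ψ` transports an `N`-th root to ITSELF up to a COHERENT isomorphism of root diagrams —
# Proposition 4.2 (iv) applied to `(R, Ψ(R) re-anchored)` (proof-only sequel of `BiKummerRootTransport.lean`)

S. Mochizuki, *The étale theta function and its Frobenioid-theoretic manifestations*, Publ. RIMS **45** (2009)
[cite: MochizukiEtTh2009, Prop 4.2 (iv) p.315 (PDF p.89); Rmk 4.3.2 p.318–319 (PDF pp.92–93); Thm 5.7 proof p.330
(PDF p.104); Cor 5.12 p.339 (PDF p.113)].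

abc-iut cell, layer L2, row R192 (B′) FILE 2 (seat abc-iut-f-121; spec abc-iut-L2-d4 `SHAPES-Thm57-residual-B.md` §1:
"Prop 4.2 (iv) … applied to the two `N`-th roots `R N` and `Ψ(R N)` of the SAME fraction pair, the latter RE-ANCHORED
…; `Prop42_iv … (R N) R′ ebs h` hands `ζ_A`, `ζ_B` … and the `μ_N(B_N)`-ambiguity `u`").  PROOF-ONLY (no `def`).

WHAT IS PROVED.  In the self-equivalence case of abc-iut-L2-t3's Theorem 4.4 hypothesis (`h : Thm44Hyp S S`, as
produced for the §5 `Ψ` by abc-iut-L2-t9's `Sec5Prop51Thm44Pin`), for an `N`-th root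
`R = (A_N, B_N, α, β, f_N, (s′_N, s″_N))` of a fraction-pair `P = (s′, s″)` of `f` on `(A_⊙, B)` (domain `A_⊙`, as
`Prop42_iv` is typed), anchors `eA : Ψ A_⊙ ≅ A_⊙`, `eB : Ψ B ≅ B` that FIX the pair (`eA⁻¹ ≫ Ψ s′ ≫ eB = s′`,
`eA⁻¹ ≫ Ψ s″ ≫ eB = s″`, `((eA)^birat)^* f = ψ f`) and a base isomorphism `ebs : A_N^bs ≅ (Ψ A_N)^bs` over `A_⊙^bs`
(`α^bs = ebs ≫ (Ψ α ≫ eA)^bs` — the Prop 2.4-type input, BY NAME), **Prop 4.2 (iv)** (`Prop42_iv`, BY NAME) yields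
`exists_coherent_isos_of_prop42_iv`:
  `∃ (a : Ψ A_N ≅ A_N) (b : Ψ B_N ≅ B_N) (u ∈ μ_N(B_N))`, `a⁻¹ ≫ Ψ α ≫ eA = α`, `b⁻¹ ≫ Ψ β ≫ eB = β`,
  `a⁻¹ ≫ Ψ s′_N ≫ b = s′_N`, `a⁻¹ ≫ Ψ s″_N ≫ b = s″_N ≫ u`, `Base(a) = ebs⁻¹`;
hence (`exists_unit_transport_of_prop42_iv`) a transport datum of the §5 shape `(a, b, e := 1, D_c := 1, D_p := u)`
with `D_c⁻¹·D_p = u ∈ μ_N(B_N) ⊆ O^×(B_N)` TOGETHER WITH the compatibility of `(a, b)` with the structural maps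
`α : A_N → A_⊙`, `β : B_N → B` — the per-level coherence «`Ψ` maps the transition diagrams to transition diagrams»
(Rmk 4.3.2; Cor 5.12 setting) in the currency of abc-iut-L2-d4's all-levels Thm 5.7 (`Sec5Thm57ChosenFamily.lean`:
`hT`, `hT′`, `hu`, and the `hΨα`/`hΨβ`-shape relative to the maps to the base pair).
HONEST FRAMING: a kernel-checked consequence of NAMED §4 inputs (`Prop42_iv`, `Thm44_ii`, T44-L03/L04b/L08/L15a/L15(⇒),
the anchor laws, the base isomorphism `ebs`); nothing is asserted for any genuine datum; refereed pre-IUT material;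
nothing here bears on [IUTchIII] Cor. 3.12 or takes a side; typed ≠ proved.
-/

namespace Literature.AnabelianGeometry.EtaleTheta

open CategoryTheory Opposite Literature.AlgebraicGeometry.Frobenioids

namespace BiKummerSetting

universe u₀ v₀ u v w

variable {K : Type u₀} [Field K] {D₀ : Type u₀} [Category.{v₀} D₀] {V : FrdIMonoidStub.{w}}
  {X₁ : SemiGraphs.TemperedArithmeticGroup.{u₀} K} {T₁ : RealifiedDivisorMonoids (D₀ := D₀) V}
  {D₁ : Type u} [Category.{v} D₁] {VD₁ : FrdICatStub.{u, v, w} D₁} {S : BiKummerSetting X₁ T₁ D₁ VD₁}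

namespace NthRoot

section

variable (h : Thm44Hyp S S) (ψ : ∀ A : S.C, S.biratUnits A ≃* S.biratUnits (h.Ψ.functor.obj A))
    (pullFrac : ∀ {A A' : S.C} (_ : A' ⟶ A), S.biratUnits A → S.biratUnits A')
    (hpull : ∀ {A A' : S.C} (φ : A' ⟶ A) (f : S.biratUnits A),
      ψ A' (pullFrac φ f) = pullFrac (h.Ψ.functor.map φ) (ψ A f))
    (hii : Thm44_ii h ψ) (h3 : h.PreservesFrobeniusStructure) (h4b : h.PreservesBaseFrobeniusTypeData)
    (h8 : h.PreservesAmple) (h15a : h.PreservesFixedByHA ψ) (h15 : h.PreservesSaturated ψ)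
    (hiv : S.Prop42_iv pullFrac)
    {B : S.C} {f : S.biratUnits S.Aodot} {P : S.FractionPair f B} {N : ℕ+} (R : S.NthRoot f P N pullFrac)
    (eA : h.Ψ.functor.obj S.Aodot ≅ S.Aodot) (eB : h.Ψ.functor.obj B ≅ B)
    (hnum : eA.inv ≫ h.Ψ.functor.map P.num ≫ eB.hom = P.num) (hden : eA.inv ≫ h.Ψ.functor.map P.den ≫ eB.hom = P.den)
    (hf : pullFrac eA.hom f = ψ S.Aodot f) (heA : S.IsIsometry eA.hom) (heB : S.IsIsometry eB.hom)
    (hArises : ∀ {X Y Y' : S.C} (G : Subgroup (Aut X)) (α₂ : X ⟶ X) (α₁ : X ⟶ Y) (e : Y ≅ Y'),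
      S.ArisesFromBaseFrobeniusPair G α₂ α₁ → S.ArisesFromBaseFrobeniusPair G α₂ (α₁ ≫ e.hom))
    (hpull₂ : ∀ {X Y Z : S.C} (φ : X ⟶ Y) (χ : Y ⟶ Z) (g : S.biratUnits Z),
      pullFrac (φ ≫ χ) g = pullFrac φ (pullFrac χ g))
    (ebs : S.base.obj R.AN ≅ S.base.obj (h.Ψ.functor.obj R.AN))
    (hebs : S.base.map R.α = ebs.hom ≫ S.base.map (h.Ψ.functor.map R.α ≫ eA.hom))

include ψ hpull hii h3 h4b h8 h15a h15 hiv hnum hden hf heA heB hArises hpull₂ hebs in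
/-- **Prop 4.2 (iv) at `(R, Ψ(R) re-anchored)`: `Ψ` carries the root diagram to itself up to a COHERENT isomorphism.**
For `h : Thm44Hyp S S`, a root `R` of a pair `P` of `f` on `(A_⊙, B)`, anchors `eA`, `eB` FIXING the pair, and a base
isomorphism `ebs : A_N^bs ≅ (Ψ A_N)^bs` over `A_⊙^bs`, there are `a : Ψ A_N ≅ A_N`, `b : Ψ B_N ≅ B_N`, `u ∈ μ_N(B_N)` with
`a⁻¹ ≫ Ψ α ≫ eA = α`, `b⁻¹ ≫ Ψ β ≫ eB = β`, `a⁻¹ ≫ Ψ s′_N ≫ b = s′_N`, `a⁻¹ ≫ Ψ s″_N ≫ b = s″_N ≫ u`, `Base(a) = ebs⁻¹`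
("after possibly replacing `s″_N` by `u ∘ s″_N` … isomorphisms `ζ_A`, `ζ_B` … `α = α′ ∘ ζ_A`, `β = β′ ∘ ζ_B`", p.315).
[cite: MochizukiEtTh2009, Prop 4.2 (iv) p.315 (PDF p.89); Rmk 4.3.2 p.318–319 (PDF pp.92–93)] -/
theorem exists_coherent_isos_of_prop42_iv :
    ∃ (a : h.Ψ.functor.obj R.AN ≅ R.AN) (b : h.Ψ.functor.obj R.BN ≅ R.BN) (u : S.mu R.BN N),
      a.inv ≫ h.Ψ.functor.map R.α ≫ eA.hom = R.α ∧
      b.inv ≫ h.Ψ.functor.map R.β ≫ eB.hom = R.β ∧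
      a.inv ≫ h.Ψ.functor.map R.pair.num ≫ b.hom = R.pair.num ∧
      a.inv ≫ h.Ψ.functor.map R.pair.den ≫ b.hom = R.pair.den ≫ (u : Aut R.BN).hom ∧
      S.base.mapIso a = ebs.symm := by
  obtain ⟨u, ζA, ζB, h₁, h₂, h₃, h₄, h₅⟩ := hiv f P N R
    (R.transport h ψ pullFrac hpull hii h3 h4b h8 h15a h15 eA eB P hnum hden hf heA heB hArises hpull₂) ebs hebs
  rw [transport_pair_num] at h₁
  rw [transport_pair_den] at h₂
  rw [transport_α] at h₃
  rw [transport_β] at h₄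
  -- the same equations with the objects of the transported root spelled `Ψ A_N`, `Ψ B_N` (definitionally equal)
  have h₁' : (ζA.hom : R.AN ⟶ h.Ψ.functor.obj R.AN) ≫ h.Ψ.functor.map R.pair.num =
      R.pair.num ≫ (ζB.hom : R.BN ⟶ h.Ψ.functor.obj R.BN) := h₁
  have h₂' : (ζA.hom : R.AN ⟶ h.Ψ.functor.obj R.AN) ≫ h.Ψ.functor.map R.pair.den =
      (R.pair.den ≫ (u : Aut R.BN).hom) ≫ (ζB.hom : R.BN ⟶ h.Ψ.functor.obj R.BN) := h₂
  have h₃' : (ζA.hom : R.AN ⟶ h.Ψ.functor.obj R.AN) ≫ h.Ψ.functor.map R.α ≫ eA.hom = R.α := h₃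
  have h₄' : (ζB.hom : R.BN ⟶ h.Ψ.functor.obj R.BN) ≫ h.Ψ.functor.map R.β ≫ eB.hom = R.β := h₄
  have h₅' : S.base.mapIso (ζA : R.AN ≅ h.Ψ.functor.obj R.AN) = ebs := h₅
  refine ⟨(ζA : R.AN ≅ h.Ψ.functor.obj R.AN).symm, (ζB : R.BN ≅ h.Ψ.functor.obj R.BN).symm, u,
    ?_, ?_, ?_, ?_, ?_⟩
  · rw [Iso.symm_inv]; exact h₃'
  · rw [Iso.symm_inv]; exact h₄'
  · rw [Iso.symm_inv, Iso.symm_hom, ← Category.assoc]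
    exact (Iso.comp_inv_eq _).mpr h₁'
  · rw [Iso.symm_inv, Iso.symm_hom, ← Category.assoc]
    exact (Iso.comp_inv_eq _).mpr h₂'
  · rw [← h₅']
    exact Iso.ext rfl

include ψ hpull hii h3 h4b h8 h15a h15 hiv hnum hden hf heA heB hArises hpull₂ hebs in
/-- **The per-level transport datum of abc-iut-L2-d4's all-levels Thm 5.7, COHERENT with the structural maps.**  Same
hypotheses; conclusion in the shape of `Sec5Thm57ChosenFamily.lean`'s binders: identifications `a : Ψ A_N ≅ A_N`,
`b : Ψ B_N ≅ B_N`, `e := 1`, `D_c := 1`, `D_p := u` with `a⁻¹ ≫ Ψ s′_N ≫ b = e ≫ s′_N ≫ D_c` (`hT`),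
`a⁻¹ ≫ Ψ s″_N ≫ b = e ≫ s″_N ≫ D_p` (`hT′`), `D_c⁻¹·D_p ∈ O^×(B_N)` (`hu`; indeed `∈ μ_N(B_N)`), AND
`a⁻¹ ≫ Ψ α ≫ eA = α`, `b⁻¹ ≫ Ψ β ≫ eB = β` (the `hΨα`/`hΨβ`-shape relative to `α`, `β`), `Base(a) = ebs⁻¹`.
[cite: MochizukiEtTh2009, Thm 5.7 proof p.330 (PDF p.104); Rmk 4.3.2 p.318–319 (PDF pp.92–93); Prop 4.2 (iv) p.315 (PDF p.89)] -/
theorem exists_unit_transport_of_prop42_iv :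
    ∃ (a : h.Ψ.functor.obj R.AN ≅ R.AN) (b : h.Ψ.functor.obj R.BN ≅ R.BN) (e : R.AN ≅ R.AN) (Dc Dp : Aut R.BN),
      a.inv ≫ h.Ψ.functor.map R.pair.num ≫ b.hom = e.hom ≫ R.pair.num ≫ Dc.hom ∧
      a.inv ≫ h.Ψ.functor.map R.pair.den ≫ b.hom = e.hom ≫ R.pair.den ≫ Dp.hom ∧
      Dc⁻¹ * Dp ∈ S.units R.BN ∧ Dc⁻¹ * Dp ∈ S.mu R.BN N ∧ e = Iso.refl _ ∧ Dc = 1 ∧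
      a.inv ≫ h.Ψ.functor.map R.α ≫ eA.hom = R.α ∧ b.inv ≫ h.Ψ.functor.map R.β ≫ eB.hom = R.β ∧
      S.base.mapIso a = ebs.symm := by
  obtain ⟨a, b, u, hα, hβ, hn, hd, hbs⟩ := exists_coherent_isos_of_prop42_iv h ψ pullFrac hpull hii h3 h4b h8 h15a
    h15 hiv R eA eB hnum hden hf heA heB hArises hpull₂ ebs hebs
  refine ⟨a, b, Iso.refl _, 1, (u : Aut R.BN), ?_, ?_, ?_, ?_, rfl, rfl, hα, hβ, hbs⟩
  · rw [hn, Iso.refl_hom, Category.id_comp]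
    show R.pair.num = R.pair.num ≫ (Iso.refl R.BN).hom
    rw [Iso.refl_hom, Category.comp_id]
  · rw [hd, Iso.refl_hom, Category.id_comp]
  · rw [inv_one, one_mul]; exact u.2.1
  · rw [inv_one, one_mul]; exact u.2

end

/-- **From the base pair to the TRANSITIONS** (Rmk 4.3.2 p.318–319 (PDF pp.92–93): the roots at levels `N ∣ N′` are
linked by `α_{N,N′}`, `β_{N,N′}`; Cor 5.12 setting: "`Ψ` maps the transition diagrams to transition diagrams").  Pure
bookkeeping for any functor `F`: if the level-`N` and level-`1` identifications `aN : F X_N ≅ X_N`, `a1 : F X_1 ≅ X_1`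
are compatible with the structural maps `αN : X_N → A`, `α1 : X_1 → A` to the COMMON base (re-anchored at `eA`), the
transition `t : X_N → X_1` lies over the base (`t ≫ α1 = αN`) and `α1` is a monomorphism, then `(aN, a1)` are compatible
with `t`: `aN⁻¹ ≫ F t ≫ a1 = t` — the `hΨα`/`hΨβ` binders of abc-iut-L2-d4's `Sec5Thm57ChosenFamily.lean` from the
conclusions of `exists_coherent_isos_of_prop42_iv` at levels `N` and `1`.
[cite: MochizukiEtTh2009, Rmk 4.3.2 p.318–319 (PDF pp.92–93)] -/
theorem transition_compat_of_base_compat {C : Type*} [Category C] (F : C ⥤ C) {XN X1 A : C}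
    (aN : F.obj XN ≅ XN) (a1 : F.obj X1 ≅ X1) (eA : F.obj A ≅ A) (αN : XN ⟶ A) (α1 : X1 ⟶ A) (t : XN ⟶ X1)
    (ht : t ≫ α1 = αN) (hN : aN.inv ≫ F.map αN ≫ eA.hom = αN) (h1 : a1.inv ≫ F.map α1 ≫ eA.hom = α1)
    [Mono α1] : aN.inv ≫ F.map t ≫ a1.hom = t := by
  have h1' : F.map α1 ≫ eA.hom = a1.hom ≫ α1 := (Iso.inv_comp_eq a1).mp h1
  rw [← cancel_mono α1, Category.assoc, Category.assoc, ← h1', ← F.map_comp_assoc, ht, hN]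

/-! ### v2 (append): the same for a pair on an ARBITRARY domain, with Prop 4.2 (iv) AT THE GIVEN PAIR as the binder

abc-iut-L2-t3's `NthRoot`/`IsSaturated` read `H_⊙` off the setting, and `Prop42_iv` is typed for pairs with domain
`A_⊙` (as print states Prop 4.2 (iii)(iv), p.314–315).  For the §5 TOWER (abc-iut-L2-t4 `ofBiKummerFamily`: the levels
`R N` are `N`-th roots of the `l`-th root's pair `Rl.pair`, whose domain `A_l` is NOT `A_⊙`) the honest per-level input
is therefore the CLAUSE of Prop 4.2 (iv) at that pair (`hivP` below) — implied by `Prop42_iv` when the domain is `A_⊙`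
(`prop42_iv_at_of_prop42_iv`), and otherwise exactly what abc-iut-L2-t3's `Prop42Sub.lean` rows L06–L08 produce for a
given pair.  Nothing else changes. -/

section anyDomain

variable (h : Thm44Hyp S S) (ψ : ∀ A : S.C, S.biratUnits A ≃* S.biratUnits (h.Ψ.functor.obj A))
    (pullFrac : ∀ {A A' : S.C} (_ : A' ⟶ A), S.biratUnits A → S.biratUnits A')
    (hpull : ∀ {A A' : S.C} (φ : A' ⟶ A) (f : S.biratUnits A),
      ψ A' (pullFrac φ f) = pullFrac (h.Ψ.functor.map φ) (ψ A f))
    (hii : Thm44_ii h ψ) (h3 : h.PreservesFrobeniusStructure) (h4b : h.PreservesBaseFrobeniusTypeData)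
    (h8 : h.PreservesAmple) (h15a : h.PreservesFixedByHA ψ) (h15 : h.PreservesSaturated ψ)
    {A B : S.C} {f : S.biratUnits A} {P : S.FractionPair f B} {N : ℕ+}
    (hivP : ∀ (R R' : S.NthRoot f P N pullFrac) (ebs : S.base.obj R.AN ≅ S.base.obj R'.AN),
      S.base.map R.α = ebs.hom ≫ S.base.map R'.α →
        ∃ (u : S.mu R.BN N) (ζA : R.AN ≅ R'.AN) (ζB : R.BN ≅ R'.BN),
          ζA.hom ≫ R'.pair.num = R.pair.num ≫ ζB.hom ∧
          ζA.hom ≫ R'.pair.den = (R.pair.den ≫ (u : Aut R.BN).hom) ≫ ζB.hom ∧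
          ζA.hom ≫ R'.α = R.α ∧ ζB.hom ≫ R'.β = R.β ∧ S.base.mapIso ζA = ebs)
    (R : S.NthRoot f P N pullFrac)
    (eA : h.Ψ.functor.obj A ≅ A) (eB : h.Ψ.functor.obj B ≅ B)
    (hnum : eA.inv ≫ h.Ψ.functor.map P.num ≫ eB.hom = P.num) (hden : eA.inv ≫ h.Ψ.functor.map P.den ≫ eB.hom = P.den)
    (hf : pullFrac eA.hom f = ψ A f) (heA : S.IsIsometry eA.hom) (heB : S.IsIsometry eB.hom)
    (hArises : ∀ {X Y Y' : S.C} (G : Subgroup (Aut X)) (α₂ : X ⟶ X) (α₁ : X ⟶ Y) (e : Y ≅ Y'),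
      S.ArisesFromBaseFrobeniusPair G α₂ α₁ → S.ArisesFromBaseFrobeniusPair G α₂ (α₁ ≫ e.hom))
    (hpull₂ : ∀ {X Y Z : S.C} (φ : X ⟶ Y) (χ : Y ⟶ Z) (g : S.biratUnits Z),
      pullFrac (φ ≫ χ) g = pullFrac φ (pullFrac χ g))
    (ebs : S.base.obj R.AN ≅ S.base.obj (h.Ψ.functor.obj R.AN))
    (hebs : S.base.map R.α = ebs.hom ≫ S.base.map (h.Ψ.functor.map R.α ≫ eA.hom))

include ψ hpull hii h3 h4b h8 h15a h15 hivP hnum hden hf heA heB hArises hpull₂ hebs in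
/-- **Prop 4.2 (iv) (clause at the given pair) at `(R, Ψ(R) re-anchored)`, ANY domain**: coherent
`a : Ψ A_N ≅ A_N`, `b : Ψ B_N ≅ B_N`, `u ∈ μ_N(B_N)` compatible with `α, β, s′_N, s″_N` (up to `u`), `Base(a) = ebs⁻¹`.
[cite: MochizukiEtTh2009, Prop 4.2 (iv) p.315 (PDF p.89); Rmk 4.3.2 p.318–319 (PDF pp.92–93)] -/
theorem exists_coherent_isos_of_prop42_iv_at :
    ∃ (a : h.Ψ.functor.obj R.AN ≅ R.AN) (b : h.Ψ.functor.obj R.BN ≅ R.BN) (u : S.mu R.BN N),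
      a.inv ≫ h.Ψ.functor.map R.α ≫ eA.hom = R.α ∧
      b.inv ≫ h.Ψ.functor.map R.β ≫ eB.hom = R.β ∧
      a.inv ≫ h.Ψ.functor.map R.pair.num ≫ b.hom = R.pair.num ∧
      a.inv ≫ h.Ψ.functor.map R.pair.den ≫ b.hom = R.pair.den ≫ (u : Aut R.BN).hom ∧
      S.base.mapIso a = ebs.symm := by
  obtain ⟨u, ζA, ζB, h₁, h₂, h₃, h₄, h₅⟩ := hivP R
    (R.transport h ψ pullFrac hpull hii h3 h4b h8 h15a h15 eA eB P hnum hden hf heA heB hArises hpull₂) ebs hebs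
  rw [transport_pair_num] at h₁
  rw [transport_pair_den] at h₂
  rw [transport_α] at h₃
  rw [transport_β] at h₄
  have h₁' : (ζA.hom : R.AN ⟶ h.Ψ.functor.obj R.AN) ≫ h.Ψ.functor.map R.pair.num =
      R.pair.num ≫ (ζB.hom : R.BN ⟶ h.Ψ.functor.obj R.BN) := h₁
  have h₂' : (ζA.hom : R.AN ⟶ h.Ψ.functor.obj R.AN) ≫ h.Ψ.functor.map R.pair.den =
      (R.pair.den ≫ (u : Aut R.BN).hom) ≫ (ζB.hom : R.BN ⟶ h.Ψ.functor.obj R.BN) := h₂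
  have h₃' : (ζA.hom : R.AN ⟶ h.Ψ.functor.obj R.AN) ≫ h.Ψ.functor.map R.α ≫ eA.hom = R.α := h₃
  have h₄' : (ζB.hom : R.BN ⟶ h.Ψ.functor.obj R.BN) ≫ h.Ψ.functor.map R.β ≫ eB.hom = R.β := h₄
  have h₅' : S.base.mapIso (ζA : R.AN ≅ h.Ψ.functor.obj R.AN) = ebs := h₅
  refine ⟨(ζA : R.AN ≅ h.Ψ.functor.obj R.AN).symm, (ζB : R.BN ≅ h.Ψ.functor.obj R.BN).symm, u,
    ?_, ?_, ?_, ?_, ?_⟩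
  · rw [Iso.symm_inv]; exact h₃'
  · rw [Iso.symm_inv]; exact h₄'
  · rw [Iso.symm_inv, Iso.symm_hom, ← Category.assoc]
    exact (Iso.comp_inv_eq _).mpr h₁'
  · rw [Iso.symm_inv, Iso.symm_hom, ← Category.assoc]
    exact (Iso.comp_inv_eq _).mpr h₂'
  · rw [← h₅']
    exact Iso.ext rfl

include ψ hpull hii h3 h4b h8 h15a h15 hivP hnum hden hf heA heB hArises hpull₂ hebs in
/-- **The coherent per-level transport datum `(a, b, e := 1, D_c := 1, D_p := u)`, ANY domain** (same conclusion as
`exists_unit_transport_of_prop42_iv`). [cite: MochizukiEtTh2009, Thm 5.7 proof p.330 (PDF p.104); Rmk 4.3.2 p.318–319 (PDF pp.92–93)] -/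
theorem exists_unit_transport_of_prop42_iv_at :
    ∃ (a : h.Ψ.functor.obj R.AN ≅ R.AN) (b : h.Ψ.functor.obj R.BN ≅ R.BN) (e : R.AN ≅ R.AN) (Dc Dp : Aut R.BN),
      a.inv ≫ h.Ψ.functor.map R.pair.num ≫ b.hom = e.hom ≫ R.pair.num ≫ Dc.hom ∧
      a.inv ≫ h.Ψ.functor.map R.pair.den ≫ b.hom = e.hom ≫ R.pair.den ≫ Dp.hom ∧
      Dc⁻¹ * Dp ∈ S.units R.BN ∧ Dc⁻¹ * Dp ∈ S.mu R.BN N ∧ e = Iso.refl _ ∧ Dc = 1 ∧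
      a.inv ≫ h.Ψ.functor.map R.α ≫ eA.hom = R.α ∧ b.inv ≫ h.Ψ.functor.map R.β ≫ eB.hom = R.β ∧
      S.base.mapIso a = ebs.symm := by
  obtain ⟨a, b, u, hα, hβ, hn, hd, hbs⟩ := exists_coherent_isos_of_prop42_iv_at h ψ pullFrac hpull hii h3 h4b h8
    h15a h15 hivP R eA eB hnum hden hf heA heB hArises hpull₂ ebs hebs
  refine ⟨a, b, Iso.refl _, 1, (u : Aut R.BN), ?_, ?_, ?_, ?_, rfl, rfl, hα, hβ, hbs⟩
  · rw [hn, Iso.refl_hom, Category.id_comp]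
    show R.pair.num = R.pair.num ≫ (Iso.refl R.BN).hom
    rw [Iso.refl_hom, Category.comp_id]
  · rw [hd, Iso.refl_hom, Category.id_comp]
  · rw [inv_one, one_mul]; exact u.2.1
  · rw [inv_one, one_mul]; exact u.2

end anyDomain

/-- The clause-binder `hivP` of the `_at` theorems is `Prop42_iv` when the pair's domain is `A_⊙`.
[cite: MochizukiEtTh2009, Prop 4.2 (iv) p.315 (PDF p.89)] -/
theorem prop42_iv_at_of_prop42_iv (pullFrac : ∀ {A A' : S.C} (_ : A' ⟶ A), S.biratUnits A → S.biratUnits A')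
    (hiv : S.Prop42_iv pullFrac) {B : S.C} (f : S.biratUnits S.Aodot) (P : S.FractionPair f B) (N : ℕ+) :
    ∀ (R R' : S.NthRoot f P N pullFrac) (ebs : S.base.obj R.AN ≅ S.base.obj R'.AN),
      S.base.map R.α = ebs.hom ≫ S.base.map R'.α →
        ∃ (u : S.mu R.BN N) (ζA : R.AN ≅ R'.AN) (ζB : R.BN ≅ R'.BN),
          ζA.hom ≫ R'.pair.num = R.pair.num ≫ ζB.hom ∧
          ζA.hom ≫ R'.pair.den = (R.pair.den ≫ (u : Aut R.BN).hom) ≫ ζB.hom ∧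
          ζA.hom ≫ R'.α = R.α ∧ ζB.hom ≫ R'.β = R.β ∧ S.base.mapIso ζA = ebs :=
  hiv f P N

end NthRoot

end BiKummerSetting

end Literature.AnabelianGeometry.EtaleTheta
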